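import Literature.Topology.FourManifolds.ChartBoxes
import Literature.Topology.FourManifolds.BraidAxisFraming
import HarnessLib

/-!
# Zone facts on the two tori of `Σ̄₂`: boxes, disjointness, flat spots, centres

Topic `Literature/Topology/FourManifolds` (block 2 of Akhmedov–Park's `X₁(m)`, Invent. Math.
181 (2010), §3; bookkeeping for the instantiation of the tube of `Σ̄₂ ⊂ T⁴ # ℂℙ²bar`,
everything PROVED, no definitions).  On the torus `T = Rechart f (S¹ × S¹)` we use four charts of
`TorusQuarterChart.lean` (bound here by their source and value formulas): the quarter charts
`eQ₂` at `x₂ = (1, 1)` and `eQ₃` at `x₃ = (ϑ⁻², 1)` scaled by `c′` (`ϑ = e^{i r₀}`,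
`0 < r₀ ≤ 1/8`, `c′² ≥ 160/sin² r₀`), and the mixed charts `eM` at `y₂ = (1, 1)`, `eM₃` at
`y₃ = (-1, 1)` scaled by `c` (`c² ≥ 67`).  We prove:

* `box₂`, `box₃` — the coordinate balls `{‖eQ‖ ≤ 2}` lie in the angular boxes of level
  `1 - sin² r₀/80` on which the first framing function is exact (`BraidAxisFraming.lean`);
* `not_box₂_box₃`, `zones_disjoint` — the two boxes (hence the neck and cap zones) are disjoint;
* `mixedBox`, `mixedBox₃`, `flat_of_mem`, `flat_of_mem₃` — the balls of the mixed charts lie in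
  the boxes `{Re σ ≥ 0.97, Re τ ≥ 0.97}`, `{Re σ ≤ -0.97, Re τ ≥ 0.97}` and in the flat spots
  `|Re σ| ≥ 3/4` of the braid;
* `cx_eM_eq`, `cx_eM₃_eq` — both mixed charts have the complex value `c (Im σ²/Re σ², Im τ/Re τ)`;
* `centre_facts` — the four centres lie in the sources with coordinate `0`.

## References

* A. Akhmedov, B. D. Park, Invent. Math. 181 (2010) 577–603, §3. [AkhmedovPark2010]
-/

noncomputable section

open scoped Manifold ContDiff Topology Real
open Set Function Complex
open Literature.Geometry.Manifold (Rechart)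

namespace Literature.Topology.FourManifolds

namespace TorusZoneFacts

/-! ### §0 Circle facts -/

/-- `e^{iπ} = -1` as a complex number, `(e^{iπ})⁻¹ = e^{iπ}`, `(σ e^{-iπ})² = σ²`. [folklore] -/
theorem circleExp_pi_facts (σ : Circle) :
    ((Circle.exp π : Circle) : ℂ) = -1 ∧ ((σ * (Circle.exp π)⁻¹ : Circle)) ^ 2 = σ ^ 2 ∧
      (((σ * (Circle.exp π)⁻¹ : Circle)) : ℂ).re = -(σ : ℂ).re := by
  have h1 : ((Circle.exp π : Circle) : ℂ) = -1 := by rw [Circle.coe_exp, Complex.exp_pi_mul_I]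
  have h2 : ((Circle.exp π)⁻¹ : Circle) ^ 2 = 1 := by
    rw [inv_pow, sq, ← Circle.exp_add, ← two_mul, Circle.exp_two_pi, inv_one]
  refine ⟨h1, by rw [mul_pow, h2, mul_one], ?_⟩
  rw [Circle.coe_mul, Circle.coe_inv_eq_conj, h1, map_neg, map_one, mul_neg, mul_one, Complex.neg_re]

/-- **The two boxes are disjoint**: `Re z₁ ≥ 1 - S²/80` and `Re (z₁ ϑ²) ≥ 1 - S²/80` cannot both
hold (`S = sin r₀`, `ϑ = e^{i r₀}`, `0 < r₀ ≤ 1/8`). [cite: AkhmedovPark2010, §3] -/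
theorem not_box₂_box₃ {r₀ : ℝ} (hr₀ : 0 < r₀) (hr₀' : r₀ ≤ 1 / 8) (z₁ : Circle)
    (h2 : 1 - Real.sin r₀ ^ 2 / 80 ≤ (z₁ : ℂ).re)
    (h3 : 1 - Real.sin r₀ ^ 2 / 80 ≤ (((z₁ * (((Circle.exp r₀)⁻¹ ^ 2 : Circle))⁻¹ : Circle)) : ℂ).re) : False := by
  obtain ⟨hS, hS8, hC, hC1, -, -, hϑ2re, hϑ2im⟩ := smallAngle_facts hr₀ hr₀'
  have hζ : ((z₁ * (((Circle.exp r₀)⁻¹ ^ 2 : Circle))⁻¹ : Circle)) = z₁ * Circle.exp r₀ ^ 2 := by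
    rw [inv_pow, inv_inv]
  rw [hζ] at h3
  have hre : (((z₁ * Circle.exp r₀ ^ 2 : Circle)) : ℂ).re =
      (z₁ : ℂ).re * (1 - 2 * Real.sin r₀ ^ 2) - (z₁ : ℂ).im * (2 * Real.sin r₀ * Real.cos r₀) := by
    rw [Circle.coe_mul, Complex.mul_re, hϑ2re, hϑ2im]
  obtain ⟨him2, -⟩ := CoordinateBoxes.abs_im_le_of_re_ge (ε := Real.sin r₀ ^ 2 / 80) (by positivity) h2
  have hy : |(z₁ : ℂ).im| < Real.sin r₀ / 4 := by
    have : (z₁ : ℂ).im ^ 2 < (Real.sin r₀ / 4) ^ 2 := by nlinarith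
    obtain ⟨h1, h2⟩ := abs_lt_of_sq_lt_sq' this (by positivity)
    exact abs_lt.2 ⟨h1, h2⟩
  have hx1 : (z₁ : ℂ).re ≤ 1 := by
    have := Complex.re_le_norm (z₁ : ℂ); rwa [Circle.norm_coe] at this
  exact far_from_third_arith hS hS8 (by linarith) hC1 hx1 hy hre (by nlinarith)

/-! ### §1 The data -/

section Data

variable {f : ModelProd (EuclideanSpace ℝ (Fin 1)) (EuclideanSpace ℝ (Fin 1)) ≃ₜ EuclideanSpace ℝ (Fin 2)}
  {cx : EuclideanSpace ℝ (Fin 2) → ℂ} {r₀ c c' : ℝ}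
  {eQ₂ eQ₃ eM eM₃ : OpenPartialHomeomorph (Rechart f (Circle × Circle)) (EuclideanSpace ℝ (Fin 2))}

variable (hcx : ∀ v, cx v = ⟨v 0, v 1⟩)
  (hr₀ : 0 < r₀) (hr₀' : r₀ ≤ 1 / 8) (hc' : 0 < c') (hc'S : 160 / Real.sin r₀ ^ 2 ≤ c' ^ 2)
  (hc : 0 < c) (hc67 : 67 ≤ c ^ 2)
  (heQ₂s : eQ₂.source = {x | (0 < ((((Rechart.out f (Circle × Circle) x).1 * (1 : Circle)⁻¹ : Circle) : ℂ)).re ∧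
        0 < ((((Rechart.out f (Circle × Circle) x).1 * (1 : Circle)⁻¹ : Circle) : ℂ) ^ 2).re) ∧
      (0 < ((((Rechart.out f (Circle × Circle) x).2 * (1 : Circle)⁻¹ : Circle) : ℂ)).re ∧
        0 < ((((Rechart.out f (Circle × Circle) x).2 * (1 : Circle)⁻¹ : Circle) : ℂ) ^ 2).re)})
  (heQ₂v : ∀ x, eQ₂ x 0 = c' * ((((((Rechart.out f (Circle × Circle) x).1 * (1 : Circle)⁻¹ : Circle) : ℂ) ^ 2).im /
        ((((Rechart.out f (Circle × Circle) x).1 * (1 : Circle)⁻¹ : Circle) : ℂ) ^ 2).re)) ∧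
      eQ₂ x 1 = c' * ((((((Rechart.out f (Circle × Circle) x).2 * (1 : Circle)⁻¹ : Circle) : ℂ) ^ 2).im /
        ((((Rechart.out f (Circle × Circle) x).2 * (1 : Circle)⁻¹ : Circle) : ℂ) ^ 2).re)))
  (heQ₃s : eQ₃.source = {x | (0 < ((((Rechart.out f (Circle × Circle) x).1 * ((Circle.exp r₀)⁻¹ ^ 2 : Circle)⁻¹ : Circle) : ℂ)).re ∧
        0 < ((((Rechart.out f (Circle × Circle) x).1 * ((Circle.exp r₀)⁻¹ ^ 2 : Circle)⁻¹ : Circle) : ℂ) ^ 2).re) ∧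
      (0 < ((((Rechart.out f (Circle × Circle) x).2 * (1 : Circle)⁻¹ : Circle) : ℂ)).re ∧
        0 < ((((Rechart.out f (Circle × Circle) x).2 * (1 : Circle)⁻¹ : Circle) : ℂ) ^ 2).re)})
  (heQ₃v : ∀ x, eQ₃ x 0 = c' * ((((((Rechart.out f (Circle × Circle) x).1 * ((Circle.exp r₀)⁻¹ ^ 2 : Circle)⁻¹ : Circle) : ℂ) ^ 2).im /
        ((((Rechart.out f (Circle × Circle) x).1 * ((Circle.exp r₀)⁻¹ ^ 2 : Circle)⁻¹ : Circle) : ℂ) ^ 2).re)) ∧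
      eQ₃ x 1 = c' * ((((((Rechart.out f (Circle × Circle) x).2 * (1 : Circle)⁻¹ : Circle) : ℂ) ^ 2).im /
        ((((Rechart.out f (Circle × Circle) x).2 * (1 : Circle)⁻¹ : Circle) : ℂ) ^ 2).re)))
  (heMs : eM.source = {x | (0 < ((((Rechart.out f (Circle × Circle) x).1 * (1 : Circle)⁻¹ : Circle) : ℂ)).re ∧
        0 < ((((Rechart.out f (Circle × Circle) x).1 * (1 : Circle)⁻¹ : Circle) : ℂ) ^ 2).re) ∧
      0 < ((((Rechart.out f (Circle × Circle) x).2 * (1 : Circle)⁻¹ : Circle) : ℂ)).re})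
  (heMv : ∀ x, eM x 0 = c * ((((((Rechart.out f (Circle × Circle) x).1 * (1 : Circle)⁻¹ : Circle) : ℂ) ^ 2).im /
        ((((Rechart.out f (Circle × Circle) x).1 * (1 : Circle)⁻¹ : Circle) : ℂ) ^ 2).re)) ∧
      eM x 1 = c * ((((Rechart.out f (Circle × Circle) x).2 * (1 : Circle)⁻¹ : Circle) : ℂ).im /
        (((Rechart.out f (Circle × Circle) x).2 * (1 : Circle)⁻¹ : Circle) : ℂ).re))
  (heM₃s : eM₃.source = {x | (0 < ((((Rechart.out f (Circle × Circle) x).1 * (Circle.exp π)⁻¹ : Circle) : ℂ)).re ∧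
        0 < ((((Rechart.out f (Circle × Circle) x).1 * (Circle.exp π)⁻¹ : Circle) : ℂ) ^ 2).re) ∧
      0 < ((((Rechart.out f (Circle × Circle) x).2 * (1 : Circle)⁻¹ : Circle) : ℂ)).re})
  (heM₃v : ∀ x, eM₃ x 0 = c * ((((((Rechart.out f (Circle × Circle) x).1 * (Circle.exp π)⁻¹ : Circle) : ℂ) ^ 2).im /
        ((((Rechart.out f (Circle × Circle) x).1 * (Circle.exp π)⁻¹ : Circle) : ℂ) ^ 2).re)) ∧
      eM₃ x 1 = c * ((((Rechart.out f (Circle × Circle) x).2 * (1 : Circle)⁻¹ : Circle) : ℂ).im /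
        (((Rechart.out f (Circle × Circle) x).2 * (1 : Circle)⁻¹ : Circle) : ℂ).re))

include hcx hr₀ hr₀' hc' hc'S heQ₂s heQ₂v in
/-- **The ball `{‖eQ₂‖ ≤ 2}` lies in the box of level `1 - sin² r₀/80` at `x₂ = (1, 1)`.**
[cite: AkhmedovPark2010, §3] -/
theorem box₂ {p : Rechart f (Circle × Circle)} (hp : p ∈ eQ₂.source) (hn : ‖cx (eQ₂ p)‖ ≤ 2) :
    1 - Real.sin r₀ ^ 2 / 80 ≤ (((Rechart.out f (Circle × Circle) p).1 : Circle) : ℂ).re ∧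
      1 - Real.sin r₀ ^ 2 / 80 ≤ (((Rechart.out f (Circle × Circle) p).2 : Circle) : ℂ).re := by
  obtain ⟨hS, -⟩ := smallAngle_facts hr₀ hr₀'
  have h2c : (2 : ℝ) ≤ c' := by
    have hS1 : Real.sin r₀ ^ 2 ≤ 1 := by nlinarith [Real.sin_sq_add_cos_sq r₀, sq_nonneg (Real.cos r₀)]
    have : (160 : ℝ) ≤ 160 / Real.sin r₀ ^ 2 := by
      rw [le_div_iff₀ (by positivity)]; nlinarith
    nlinarith
  obtain ⟨h1, h2⟩ := ChartBoxes.re_ge_of_norm_quarterChart_le hcx hc' heQ₂s heQ₂v hp (by norm_num) h2c hn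
  rw [inv_one, mul_one] at h1 h2
  have hlev := ChartBoxes.boxLevel_le hS hc' hc'S (by norm_num : (0 : ℝ) ≤ 2) le_rfl
  exact ⟨hlev.trans h1, hlev.trans h2⟩

include hcx hr₀ hr₀' hc' hc'S heQ₃s heQ₃v in
/-- **The ball `{‖eQ₃‖ ≤ 2}` lies in the box of level `1 - sin² r₀/80` at `x₃ = (ϑ⁻², 1)`.**
[cite: AkhmedovPark2010, §3] -/
theorem box₃ {p : Rechart f (Circle × Circle)} (hp : p ∈ eQ₃.source) (hn : ‖cx (eQ₃ p)‖ ≤ 2) :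
    1 - Real.sin r₀ ^ 2 / 80 ≤
        ((((Rechart.out f (Circle × Circle) p).1 * (((Circle.exp r₀)⁻¹ ^ 2 : Circle))⁻¹ : Circle)) : ℂ).re ∧
      1 - Real.sin r₀ ^ 2 / 80 ≤ (((Rechart.out f (Circle × Circle) p).2 : Circle) : ℂ).re := by
  obtain ⟨hS, -⟩ := smallAngle_facts hr₀ hr₀'
  have h2c : (2 : ℝ) ≤ c' := by
    have hS1 : Real.sin r₀ ^ 2 ≤ 1 := by nlinarith [Real.sin_sq_add_cos_sq r₀, sq_nonneg (Real.cos r₀)]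
    have : (160 : ℝ) ≤ 160 / Real.sin r₀ ^ 2 := by
      rw [le_div_iff₀ (by positivity)]; nlinarith
    nlinarith
  obtain ⟨h1, h2⟩ := ChartBoxes.re_ge_of_norm_quarterChart_le hcx hc' heQ₃s heQ₃v hp (by norm_num) h2c hn
  rw [inv_one, mul_one] at h2
  have hlev := ChartBoxes.boxLevel_le hS hc' hc'S (by norm_num : (0 : ℝ) ≤ 2) le_rfl
  exact ⟨hlev.trans h1, hlev.trans h2⟩

include hcx hr₀ hr₀' hc' hc'S heQ₂s heQ₂v heQ₃s heQ₃v in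
/-- **The neck and cap zones are disjoint**: no point lies in both balls `{‖eQ₂‖ ≤ 2}` and
`{‖eQ₃‖ ≤ 2}`. [cite: AkhmedovPark2010, §3] -/
theorem zones_disjoint {p : Rechart f (Circle × Circle)} (hp₂ : p ∈ eQ₂.source) (hn₂ : ‖cx (eQ₂ p)‖ ≤ 2)
    (hp₃ : p ∈ eQ₃.source) (hn₃ : ‖cx (eQ₃ p)‖ ≤ 2) : False :=
  not_box₂_box₃ hr₀ hr₀' _ (box₂ hcx hr₀ hr₀' hc' hc'S heQ₂s heQ₂v hp₂ hn₂).1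
    (box₃ hcx hr₀ hr₀' hc' hc'S heQ₃s heQ₃v hp₃ hn₃).1

include hcx hc hc67 heMs heMv in
/-- **The ball `{‖eM‖ ≤ 2}` lies in the box `{Re σ ≥ 0.97, Re τ ≥ 0.97}`.** [cite: AkhmedovPark2010, §3] -/
theorem mixedBox {w : Rechart f (Circle × Circle)} (hw : w ∈ eM.source) (hn : ‖cx (eM w)‖ ≤ 2) :
    97 / 100 ≤ (((Rechart.out f (Circle × Circle) w).1 : Circle) : ℂ).re ∧
      97 / 100 ≤ (((Rechart.out f (Circle × Circle) w).2 : Circle) : ℂ).re := by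
  have h2c : (2 : ℝ) ≤ c := by nlinarith
  obtain ⟨h1, h2⟩ := ChartBoxes.re_ge_of_norm_mixedChart_le hcx hc heMs heMv hw (by norm_num) h2c hn
  rw [inv_one, mul_one] at h1 h2
  have hlev : (97 : ℝ) / 100 ≤ 1 - (2 / c) ^ 2 / 2 := by
    rw [div_pow]
    have : (4 : ℝ) / c ^ 2 ≤ 6 / 100 := by
      rw [div_le_div_iff₀ (by positivity) (by norm_num)]; nlinarith
    norm_num at this ⊢; linarith
  exact ⟨hlev.trans h1, hlev.trans h2⟩

include hcx hc hc67 heM₃s heM₃v in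
/-- **The ball `{‖eM₃‖ ≤ 2}` lies in the box `{Re σ ≤ -0.97, Re τ ≥ 0.97}`.** [cite: AkhmedovPark2010, §3] -/
theorem mixedBox₃ {w : Rechart f (Circle × Circle)} (hw : w ∈ eM₃.source) (hn : ‖cx (eM₃ w)‖ ≤ 2) :
    (((Rechart.out f (Circle × Circle) w).1 : Circle) : ℂ).re ≤ -(97 / 100) ∧
      97 / 100 ≤ (((Rechart.out f (Circle × Circle) w).2 : Circle) : ℂ).re := by
  have h2c : (2 : ℝ) ≤ c := by nlinarith
  obtain ⟨h1, h2⟩ := ChartBoxes.re_ge_of_norm_mixedChart_le hcx hc heM₃s heM₃v hw (by norm_num) h2c hn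
  rw [inv_one, mul_one] at h2
  rw [(circleExp_pi_facts _).2.2] at h1
  have hlev : (97 : ℝ) / 100 ≤ 1 - (2 / c) ^ 2 / 2 := by
    rw [div_pow]
    have : (4 : ℝ) / c ^ 2 ≤ 6 / 100 := by
      rw [div_le_div_iff₀ (by positivity) (by norm_num)]; nlinarith
    norm_num at this ⊢; linarith
  exact ⟨by linarith, hlev.trans h2⟩

include hcx heMv in
/-- **The complex value of the mixed chart at `(1, 1)`** is `c (Im σ²/Re σ², Im τ/Re τ)`. [folklore] -/
theorem cx_eM_eq (w : Rechart f (Circle × Circle)) :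
    cx (eM w) = ⟨c * (((((Rechart.out f (Circle × Circle) w).1 : Circle) : ℂ) ^ 2).im /
        ((((Rechart.out f (Circle × Circle) w).1 : Circle) : ℂ) ^ 2).re),
      c * ((((Rechart.out f (Circle × Circle) w).2 : Circle) : ℂ).im /
        (((Rechart.out f (Circle × Circle) w).2 : Circle) : ℂ).re)⟩ := by
  obtain ⟨e0, e1⟩ := heMv w
  simp only [inv_one, mul_one] at e0 e1
  rw [hcx, e0, e1]

include hcx heM₃v in
/-- **The complex value of the mixed chart at `(-1, 1)`** is the SAME formula
`c (Im σ²/Re σ², Im τ/Re τ)` (`(σ e^{-iπ})² = σ²`). [folklore] -/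
theorem cx_eM₃_eq (w : Rechart f (Circle × Circle)) :
    cx (eM₃ w) = ⟨c * (((((Rechart.out f (Circle × Circle) w).1 : Circle) : ℂ) ^ 2).im /
        ((((Rechart.out f (Circle × Circle) w).1 : Circle) : ℂ) ^ 2).re),
      c * ((((Rechart.out f (Circle × Circle) w).2 : Circle) : ℂ).im /
        (((Rechart.out f (Circle × Circle) w).2 : Circle) : ℂ).re)⟩ := by
  obtain ⟨e0, e1⟩ := heM₃v w
  simp only [inv_one, mul_one] at e1
  rw [← Circle.coe_pow, (circleExp_pi_facts _).2.1, Circle.coe_pow] at e0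
  rw [hcx, e0, e1]

include hcx hc hc67 heMs heMv in
/-- **The ball `{‖eM‖ ≤ 2}` lies in the flat spot `Re σ ≥ 3/4`**, with `Re σ² > 0`, `Re τ > 0`.
[cite: AkhmedovPark2010, §3] -/
theorem flat_of_mem {w : Rechart f (Circle × Circle)} (hw : w ∈ eM.source) (hn : ‖cx (eM w)‖ ≤ 2) :
    3 / 4 ≤ (((Rechart.out f (Circle × Circle) w).1 : Circle) : ℂ).re ∧
      0 < (((((Rechart.out f (Circle × Circle) w).1 : Circle) : ℂ)) ^ 2).re ∧
      0 < (((Rechart.out f (Circle × Circle) w).2 : Circle) : ℂ).re := by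
  obtain ⟨h1, h2⟩ := mixedBox hcx hc hc67 heMs heMv hw hn
  have hw' := hw
  rw [heMs] at hw'
  obtain ⟨⟨-, hsq⟩, -⟩ := hw'
  rw [inv_one, mul_one] at hsq
  exact ⟨by linarith, hsq, by linarith⟩

include hcx hc hc67 heM₃s heM₃v in
/-- **The ball `{‖eM₃‖ ≤ 2}` lies in the flat spot `Re σ ≤ -3/4`**, with `Re σ² > 0`, `Re τ > 0`.
[cite: AkhmedovPark2010, §3] -/
theorem flat_of_mem₃ {w : Rechart f (Circle × Circle)} (hw : w ∈ eM₃.source) (hn : ‖cx (eM₃ w)‖ ≤ 2) :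
    (((Rechart.out f (Circle × Circle) w).1 : Circle) : ℂ).re ≤ -(3 / 4) ∧
      0 < (((((Rechart.out f (Circle × Circle) w).1 : Circle) : ℂ)) ^ 2).re ∧
      0 < (((Rechart.out f (Circle × Circle) w).2 : Circle) : ℂ).re := by
  obtain ⟨h1, h2⟩ := mixedBox₃ hcx hc hc67 heM₃s heM₃v hw hn
  have hw' := hw
  rw [heM₃s] at hw'
  obtain ⟨⟨-, hsq⟩, -⟩ := hw'
  rw [← Circle.coe_pow, (circleExp_pi_facts _).2.1, Circle.coe_pow] at hsq
  exact ⟨by linarith, hsq, by linarith⟩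

include heQ₂s heQ₃s heMs heM₃s in
/-- **The four centres lie in the chart sources.** [folklore] -/
theorem centre_mem :
    Rechart.into f (Circle × Circle) ((1 : Circle), (1 : Circle)) ∈ eQ₂.source ∧
      Rechart.into f (Circle × Circle) ((((Circle.exp r₀)⁻¹ ^ 2 : Circle)), (1 : Circle)) ∈ eQ₃.source ∧
      Rechart.into f (Circle × Circle) ((1 : Circle), (1 : Circle)) ∈ eM.source ∧
      Rechart.into f (Circle × Circle) ((Circle.exp π : Circle), (1 : Circle)) ∈ eM₃.source := by
  have h1 : (0 : ℝ) < ((1 : Circle) : ℂ).re := by rw [Circle.coe_one, Complex.one_re]; exact one_pos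
  have h2 : (0 : ℝ) < ((((1 : Circle) : ℂ)) ^ 2).re := by rw [Circle.coe_one, one_pow, Complex.one_re]; exact one_pos
  refine ⟨?_, ?_, ?_, ?_⟩
  · rw [heQ₂s, mem_setOf_eq, Rechart.out_into]
    simp only [inv_one, mul_one]
    exact ⟨⟨h1, h2⟩, ⟨h1, h2⟩⟩
  · rw [heQ₃s, mem_setOf_eq, Rechart.out_into]
    simp only [mul_inv_cancel, inv_one, mul_one]
    exact ⟨⟨h1, h2⟩, ⟨h1, h2⟩⟩
  · rw [heMs, mem_setOf_eq, Rechart.out_into]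
    simp only [inv_one, mul_one]
    exact ⟨⟨h1, h2⟩, h1⟩
  · rw [heM₃s, mem_setOf_eq, Rechart.out_into]
    simp only [mul_inv_cancel, inv_one, mul_one]
    exact ⟨⟨h1, h2⟩, h1⟩

include hcx in
/-- A chart value `0` has complex coordinate `0`, and conversely on the source the complex
coordinate vanishes only at the centre (charts are injective). [folklore] -/
theorem cx_eq_zero_iff {e : OpenPartialHomeomorph (Rechart f (Circle × Circle)) (EuclideanSpace ℝ (Fin 2))}
    {x₀ : Rechart f (Circle × Circle)} (hx₀ : x₀ ∈ e.source) (he0 : e x₀ = 0) {p : Rechart f (Circle × Circle)}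
    (hp : p ∈ e.source) : cx (e p) = 0 ↔ p = x₀ := by
  have hcx0 : cx 0 = 0 := by rw [hcx]; apply Complex.ext <;> simp
  constructor
  · intro h
    have h1 : e p = e x₀ := by
      rw [he0]; exact NeckPiece.cx_injective hcx (by rw [h, hcx0])
    exact e.injOn hp hx₀ h1
  · rintro rfl; rw [he0, hcx0]

end Data

end TorusZoneFacts

end Literature.Topology.FourManifolds
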